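import Summits.CriticalPhenomena.PercolationContinuityZ3.Theorems.PercNearOneGluingNoHeavyQuantDFSCodes
import HarnessLib

/-!
# QUANT lane / PAPER-2 rate track (ARM-1, gen 3): counting `★`-animals by depth-first codes —
# `#{★-connected Y ∋ v, #Y = m} ≤ binom(2(m−1), m−1)·(3^d − 1)^{m−1} ≤ (4(3^d − 1))^{m−1}`

builds on p205010 (kernel theorem, internal audit signed; external expert review pending)

Cell `prim-quant`, seat `prim-quant-arm-1` (rate-theorem architect), memo `run/shared/lean/prim/quant/RATE-PLAN.md` §11.6 (i).
Second of two files (machine: `…QuantDFSCodes`).  The tree counts the `★`-animals of size `m` through a point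
(`Literature.Probability.Percolation.starAnimals`, the candidate blocking sets of every Peierls argument on renormalised sites) by closed
LAZY walks: `card_starAnimals_le : #starAnimals v m ≤ (3^d + 1)^{2(m−1)}` (`= 100^{m−1}` in `d = 2`).  Here:
* `card_dfsFamily_le`/`_pow` — `#dfsFamily nbr Δ x n ≤ binom(2n, n)·Δ^n ≤ (4Δ)^n`;
* `mem_dfsFamily` — every finite `S ∋ x` connected from `x` by `R`-chains inside `S` (`R a b → b ∈ nbr a`, `#nbr a ≤ Δ`) is a depth-first
  trace: `S ∈ dfsFamily nbr Δ x (#S − 1)` (induction on `#S`: remove a far point `z` with predecessor `z'` — `DFSCount.exists_leaf` —, trace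
  `S ∖ {z}` by `w = w₁ ++ w₂` with `z'` on top after `w₁`, splice `push a, pop` with `pick z' a = z`);
* `lazyWalk_support` — the support of a lazy walk from `v` contains `v` and is connected from `v` by proper steps inside it;
* `StarPeierls.card_starAnimals_le_dfs : #starAnimals v m ≤ (4·(3^d − 1))^{m−1}` (punctured `★`-balls, `Δ = 3^d − 1`; `d = 2`:
  `32^{m−1}`, `card_starAnimals_two_le`) — this moves the threshold of the exploration-process driver of Kozma–Nitzan's Theorem 6 from
  `2⁻⁸` (P2 `…QuantPeierlsStarDriver`) to `2⁻⁶` (P2′ `…QuantPeierlsStarDriverSix`).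
Pure combinatorics; no percolation input.  (Lyons–Peres, *Probability on Trees and Networks*, Ex. 7.39: `limsup a_n^{1/n} < eΔ`.) [folklore]
-/

noncomputable section

namespace Summit.CriticalPhenomena.PercolationContinuityZ3.Theorems.Quant.DFSCount

open Finset Relation
open scoped Classical

variable {V : Type*} [DecidableEq V]

/-! ## Every connected set is a depth-first trace -/

section Family

variable (nbr : V → Finset V) (Δ : ℕ)


variable {nbr Δ}

/-- **Counting**: `#dfsFamily ≤ binom(2n, n)·Δ^n`.
builds on p205010 (kernel theorem, internal audit signed; external expert review pending). [folklore] -/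
theorem card_dfsFamily_le (x : V) (n : ℕ) : (dfsFamily nbr Δ x n).card ≤ (2 * n).choose n * Δ ^ n :=
  card_image_le.trans (card_codes_le Δ (2 * n) n)

/-- **Counting, closed form**: `#dfsFamily ≤ (4Δ)^n` (`binom(2n, n) ≤ 4^n`, `Nat.centralBinom_le_four_pow`).
builds on p205010 (kernel theorem, internal audit signed; external expert review pending). [folklore] -/
theorem card_dfsFamily_le_pow (x : V) (n : ℕ) : (dfsFamily nbr Δ x n).card ≤ (4 * Δ) ^ n := by
  refine (card_dfsFamily_le x n).trans ?_
  rw [mul_pow, ← Nat.centralBinom_eq_two_mul_choose]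
  exact Nat.mul_le_mul_right _ (Nat.centralBinom_le_four_pow n)

/-- **Every connected set through `x` is a depth-first trace.**  If `R a b → b ∈ nbr a`, `#nbr a ≤ Δ` for all `a`, and the finite
`S ∋ x` is connected from `x` by `R`-chains inside `S`, then `S ∈ dfsFamily nbr Δ x (#S − 1)`.  (Induction on `#S`: remove a far point
`z` with predecessor `z'` (`exists_leaf`), trace `S ∖ {z}` by a word `w = w₁ ++ w₂` with `z'` on top after `w₁`
(`exists_prefix_of_mem_visit`), and splice `push a, pop` with `pick z' a = z` between `w₁` and `w₂`.)
builds on p205010 (kernel theorem, internal audit signed; external expert review pending). [folklore] -/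
theorem mem_dfsFamily {R : V → V → Prop} (hnbr : ∀ a b, R a b → b ∈ nbr a) (hΔ : ∀ a, (nbr a).card ≤ Δ) :
    ∀ (n : ℕ) {S : Finset V} {x : V}, S.card = n + 1 → x ∈ S →
      (∀ w ∈ S, ReflTransGen (fun a b => R a b ∧ a ∈ S ∧ b ∈ S) x w) → S ∈ dfsFamily nbr Δ x n
  | 0, S, x, hcard, hx, _ => by
    obtain ⟨y, hy⟩ := card_eq_one.1 hcard
    subst hy
    have hxy : x = y := mem_singleton.1 hx
    subst hxy
    simp only [dfsFamily, mem_image, Nat.mul_zero]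
    exact ⟨[], mem_codes_iff.2 ⟨rfl, rfl⟩, by simp [visit, headSet]⟩
  | n + 1, S, x, hcard, hx, hconn => by
    obtain ⟨z, hzS, hzx, ⟨z', hz', hRz⟩, hconn'⟩ := exists_leaf hx hconn (by omega)
    have hcard' : (S.erase z).card = n + 1 := by rw [card_erase_of_mem hzS, hcard]; omega
    have hx' : x ∈ S.erase z := mem_erase.2 ⟨hzx.symm, hx⟩
    have hmem := mem_dfsFamily hnbr hΔ n hcard' hx' hconn'
    simp only [dfsFamily, mem_image] at hmem ⊢
    obtain ⟨w, hw, hvisit⟩ := hmem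
    obtain ⟨hwlen, hwcount⟩ := mem_codes_iff.1 hw
    -- `z'` is on top after some prefix
    have hz'v : z' ∈ visit nbr Δ w [x] := by rw [hvisit]; exact hz'
    obtain ⟨w₁, w₂, rfl, rest, hrun⟩ := exists_prefix_of_mem_visit hz'v
    obtain ⟨a, ha⟩ := exists_pick_eq hΔ (hnbr z' z hRz)
    refine ⟨w₁ ++ (some a :: none :: w₂), mem_codes_iff.2 ⟨?_, ?_⟩, ?_⟩
    · simp only [List.length_append, List.length_cons] at hwlen ⊢; omega
    · simp only [List.countP_append, List.countP_cons, Option.isSome_some, Option.isSome_none, ite_true,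
        Bool.false_eq_true, ite_false] at hwcount ⊢
      omega
    · have hsplit : some a :: none :: w₂ = [some a, none] ++ w₂ := rfl
      rw [visit_append, hsplit, visit_append, hrun, run_push_pop, visit_push_pop, ha, ← hrun, ← union_assoc,
        union_right_comm, ← visit_append, hvisit]
      -- `S.erase z ∪ {z', z} = S`
      ext y
      simp only [mem_union, mem_erase, mem_insert, mem_singleton]
      constructor
      · rintro (⟨-, hy⟩ | rfl | rfl)
        · exact hy
        · exact (mem_erase.1 hz').2
        · exact hzS
      · intro hy
        by_cases hyz : y = z
        · exact Or.inr (Or.inr hyz)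
        · exact Or.inl ⟨hyz, hy⟩

end Family

/-! ## Supports of lazy walks are connected from the start -/

/-- The support of a lazy walk from `v` contains `v` and is connected from `v` by steps `a → b` with `b ∈ nbr a`, `b ≠ a`, inside the support.
builds on p205010 (kernel theorem, internal audit signed; external expert review pending). [folklore] -/
theorem lazyWalk_support {nbr : V → Finset V} {v : V} :
    ∀ {k : ℕ} {l : List V}, l ∈ Literature.Probability.LatticeModels.lazyWalks nbr v k →
      v ∈ l.toFinset ∧ ∀ w ∈ l.toFinset,
        ReflTransGen (fun a b => (b ∈ nbr a ∧ b ≠ a) ∧ a ∈ l.toFinset ∧ b ∈ l.toFinset) v w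
  | 0, l, hl => by
    simp only [Literature.Probability.LatticeModels.lazyWalks, mem_singleton] at hl
    subst hl
    refine ⟨by simp, fun w hw => ?_⟩
    simp only [List.toFinset_cons, List.toFinset_nil, insert_empty_eq, mem_singleton] at hw
    subst hw
    exact ReflTransGen.refl
  | k + 1, l, hl => by
    simp only [Literature.Probability.LatticeModels.lazyWalks, mem_biUnion] at hl
    obtain ⟨l', hl', hll'⟩ := hl
    obtain ⟨hv', hconn'⟩ := lazyWalk_support hl'
    match l', hll' with
    | [], hll' => simp [Literature.Probability.LatticeModels.lazyExtend] at hll'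
    | x :: t, hll' =>
      simp only [Literature.Probability.LatticeModels.lazyExtend, mem_image, mem_insert] at hll'
      obtain ⟨y, hy, rfl⟩ := hll'
      have hsub : (x :: t).toFinset ⊆ (y :: x :: t).toFinset := by
        intro w hw; simp only [List.toFinset_cons, mem_insert] at hw ⊢; tauto
      have hmono : ∀ w ∈ (x :: t).toFinset,
          ReflTransGen (fun a b => (b ∈ nbr a ∧ b ≠ a) ∧ a ∈ (y :: x :: t).toFinset ∧ b ∈ (y :: x :: t).toFinset) v w :=
        fun w hw => ReflTransGen.mono (fun a b h => ⟨h.1, hsub h.2.1, hsub h.2.2⟩) v w (hconn' w hw)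
      refine ⟨hsub hv', fun w hw => ?_⟩
      by_cases hwt : w ∈ (x :: t).toFinset
      · exact hmono w hwt
      · have hwy : w = y := by
          simp only [List.toFinset_cons, mem_insert] at hw hwt
          tauto
        subst hwy
        rcases hy with rfl | hy
        · exact absurd (by simp) hwt
        · have hx : x ∈ (x :: t).toFinset := by simp
          have hne : w ≠ x := fun h => hwt (h ▸ hx)
          exact ReflTransGen.tail (hmono x hx) ⟨⟨hy, hne⟩, hsub hx, by simp⟩

end Summit.CriticalPhenomena.PercolationContinuityZ3.Theorems.Quant.DFSCount

/-! ## The lattice corollary: `★`-animals on `ℤ^d` -/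

namespace Summit.CriticalPhenomena.PercolationContinuityZ3.Theorems.Quant.StarPeierls

open Finset Relation Literature.Probability.LatticeModels Literature.Probability.Percolation
open Summit.CriticalPhenomena.PercolationContinuityZ3.Theorems.Quant.DFSCount

variable {d : ℕ}

/-- The punctured `★`-ball has `3^d − 1` points.
builds on p205010 (kernel theorem, internal audit signed; external expert review pending). [folklore] -/
theorem card_starBall_erase (x : Site d) : ((starBall x).erase x).card = 3 ^ d - 1 := by
  rw [card_erase_of_mem (mem_starBall_self x), card_starBall]

/-- Every `★`-animal of size `m` through `v` is a depth-first trace of size parameter `m − 1` for the punctured `★`-balls.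
builds on p205010 (kernel theorem, internal audit signed; external expert review pending). [folklore] -/
theorem starAnimals_subset_dfsFamily (v : Site d) (m : ℕ) :
    starAnimals v m ⊆ dfsFamily (fun x : Site d => (starBall x).erase x) (3 ^ d - 1) v (m - 1) := by
  classical
  intro Y hY
  simp only [starAnimals, mem_filter, mem_image] at hY
  obtain ⟨⟨l, hl, rfl⟩, hcard⟩ := hY
  obtain ⟨hv, hconn⟩ := lazyWalk_support hl
  have hn : l.toFinset.card = (m - 1) + 1 := by
    have : 1 ≤ l.toFinset.card := card_pos.2 ⟨v, hv⟩
    omega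
  exact mem_dfsFamily (R := fun a b : Site d => b ∈ starBall a ∧ b ≠ a)
    (fun a b h => mem_erase.2 ⟨h.2, h.1⟩) (fun a => (card_starBall_erase a).le) (m - 1) hn hv hconn

/-- **Counting `★`-animals by depth-first codes**: `#starAnimals v m ≤ binom(2(m−1), m−1)·(3^d − 1)^{m−1}`.
builds on p205010 (kernel theorem, internal audit signed; external expert review pending). [folklore] -/
theorem card_starAnimals_le_choose (v : Site d) (m : ℕ) :
    (starAnimals v m).card ≤ (2 * (m - 1)).choose (m - 1) * (3 ^ d - 1) ^ (m - 1) :=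
  (card_le_card (starAnimals_subset_dfsFamily v m)).trans (card_dfsFamily_le v (m - 1))

/-- **Counting `★`-animals, closed form**: `#starAnimals v m ≤ (4·(3^d − 1))^{m−1}` (`= 32^{m−1}` for `d = 2`; the tree's walk count
`card_starAnimals_le` gives `(3^d+1)^{2(m−1)} = 100^{m−1}`).
builds on p205010 (kernel theorem, internal audit signed; external expert review pending). [folklore] -/
theorem card_starAnimals_le_dfs (v : Site d) (m : ℕ) : (starAnimals v m).card ≤ (4 * (3 ^ d - 1)) ^ (m - 1) :=
  (card_le_card (starAnimals_subset_dfsFamily v m)).trans (card_dfsFamily_le_pow v (m - 1))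

/-- `d = 2`: at most `32^{m−1}` `★`-animals of size `m` through a point of `ℤ²`.
builds on p205010 (kernel theorem, internal audit signed; external expert review pending). [folklore] -/
theorem card_starAnimals_two_le (v : Site 2) (m : ℕ) : (starAnimals v m).card ≤ 32 ^ (m - 1) := by
  simpa using card_starAnimals_le_dfs v m

end Summit.CriticalPhenomena.PercolationContinuityZ3.Theorems.Quant.StarPeierls

end
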